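import Summits.ResolutionOfSingularities.ResolutionOfSingularities.Theorems.HilbertSamuelEliminationCampaignW42ToricMarkedCoeff2
import Summits.ResolutionOfSingularities.ResolutionOfSingularities.Theorems.HilbertSamuelEliminationCampaignW42ToricMarkedPairPot
import Mathlib.Data.Prod.Lex

/-!
# [OURS · L1 W4.2] Toric marked monomial objects in dimension 3 — brick 5A: the TERMINATION POTENTIAL `Λ` of a corner in a phase

[OURS · L1 W4.2 · seat res-L1-s42-pv-2 gen 5] Memo `L/res-L1-s42-pv-2/CALIBRATION-W42-O2-v4.md` §3 (F6), with the simplification found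
afterwards (kit census, 18 960 positions, 0 violations): with the pair-width potential `T` (brick 4A) in place of the Pareto wall, the lexicographic
potential `Λ(C) = (3 − |K(C)|, T-link, psum-link)` read in the coefficient object `𝒞_k`, `k = min K(C)`, drops STRICTLY on every `θ*`-child under
BOTH kinds of moves of procedure Q (admissible curve = translation ⇒ `psum` drops by `θ*·L`; point = child maps ⇒ `T` drops, or `psum` drops at
principal link cones with reduced rays), so no separate finiteness argument for curve stages is needed.  This file only FIXES THE DEFINITIONS
(`linkT`, `bmin2`, `psum2`, `kmin`, `Lam`) and proves the order-independence / non-negativity facts they rest on; the per-move decrease and the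
Dershowitz–Manna assembly are bricks 5B/6.  NOT a statement of the manuscript under review nor of Blanco / Encinas–Villamayor.  AI work, weaker than
expert review.  No `sorry`, no new axiom.
-/

set_option linter.dupNamespace false -- mandated namespace of this single-conjunct summit

namespace Summit.ResolutionOfSingularities.ResolutionOfSingularities.Theorems.CampaignW42.Toric

open Finset

namespace PairPot

variable {γ : Type}

/-- The width term is symmetric under swapping the coordinates together with the pair. -/
theorem term_swap (x y : γ → ℤ) (g g' : γ) : term x y g g' = term y x g' g := by
  unfold term
  by_cases h : x g < x g' ∧ y g' < y g
  · rw [if_pos h, if_pos ⟨h.2, h.1⟩]; ring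
  · rw [if_neg h, if_neg (fun h' => h ⟨h'.2, h'.1⟩)]

/-- **The pair-width potential is symmetric in the two coordinates** (so the link potential of a corner does not depend on the order of its
two link rays). -/
theorem T_symm (G : Finset γ) (x y : γ → ℤ) : T G x y = T G y x := by
  unfold T
  rw [Finset.sum_comm]
  exact Finset.sum_congr rfl (fun g' _ => Finset.sum_congr rfl (fun g _ => term_swap x y g g'))

end PairPot

namespace TState

variable {ι : Type} [Fintype ι] [Nonempty ι] [DecidableEq ι]

/-- Scaled coefficient exponents are non-negative (non-negative state, positive phase value, `L` a common multiple). -/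
theorem E2_nonneg {m : ℕ} {s : TState ι} (hs : s.Nonneg) {θs L : ℤ} (hθ : 0 < θs) (hL : CommonMult m θs L) (k r : ℕ)
    {g : Option ι} (hg : g ∈ s.G2 m θs k) : 0 ≤ s.E2 m θs L k r g := by
  cases g with
  | some u =>
    have hu := mem_G2_some.mp hg
    have hd : 0 < θs - s.alpha k u := by omega
    have hdvd := hL.2 _ hd (le_max_of_le_left (by have := s.alpha_nonneg k u; omega))
    have hq : 0 ≤ L / (θs - s.alpha k u) := (Int.ediv_pos_of_pos_of_dvd hL.1 hd.le hdvd).le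
    show 0 ≤ s.alpha r u * θs * (L / (θs - s.alpha k u))
    exact mul_nonneg (mul_nonneg (s.alpha_nonneg r u) hθ.le) hq
  | none =>
    obtain ⟨hθm, hβ⟩ := mem_G2_none.mp hg
    have hd : 0 < (m : ℤ) - θs - s.beta k := by omega
    have hdvd := hL.2 _ hd (le_max_of_le_right (by have := beta_nonneg hs k; omega))
    have hq : 0 ≤ L / ((m : ℤ) - θs - s.beta k) := (Int.ediv_pos_of_pos_of_dvd hL.1 hd.le hdvd).le
    show 0 ≤ s.beta r * θs * (L / ((m : ℤ) - θs - s.beta k))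
    exact mul_nonneg (mul_nonneg (beta_nonneg hs r) hθ.le) hq

/-- **[OURS · L1 W4.2]** The LINK POTENTIAL `T` of the corner `C` at its ray `k`: the pair-width potential of the configuration of scaled
coefficient exponents of `𝒞_k` at the two other rays of `C` (order-independent by `PairPot.T_symm`; `0` if `C ∖ k` is empty). -/
noncomputable def linkT (s : TState ι) (m : ℕ) (θs L : ℤ) (k : ℕ) (C : Finset ℕ) : ℤ :=
  if h : (C.erase k).Nonempty then
    PairPot.T (s.G2 m θs k) (s.E2 m θs L k ((C.erase k).min' h)) (s.E2 m θs L k ((C.erase k).max' h))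
  else 0

/-- **[OURS · L1 W4.2]** `β₂(r̄)`: the minimal scaled coefficient exponent of `𝒞_k` at the link ray `r` (`0` on an empty generator set). -/
noncomputable def bmin2 (s : TState ι) (m : ℕ) (θs L : ℤ) (k r : ℕ) : ℤ :=
  if h : (s.G2 m θs k).Nonempty then (s.G2 m θs k).inf' h (s.E2 m θs L k r) else 0

/-- **[OURS · L1 W4.2]** The LINK MINIMUM SUM `psum` of the corner `C` at `k`: `Σ_{r ∈ C ∖ k} β₂(r̄)`. -/
noncomputable def psum2 (s : TState ι) (m : ℕ) (θs L : ℤ) (k : ℕ) (C : Finset ℕ) : ℤ := ∑ r ∈ C.erase k, s.bmin2 m θs L k r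

/-- **[OURS · L1 W4.2]** The chosen maximal-contact ray `k(C) := min K(C)` (`0` if `K(C)` is empty, i.e. at principal corners). -/
noncomputable def kmin (s : TState ι) (C : Finset ℕ) : ℕ :=
  if h : (s.Kset C).Nonempty then (s.Kset C).min' h else 0

/-- **[OURS · L1 W4.2]** THE TERMINATION POTENTIAL of a corner in the phase `(m, θs, L)`:
`Λ(C) = (3 − |K(C)|, linkT, psum2)` read at `k = k(C)`, in the lexicographic order. -/
noncomputable def Lam (s : TState ι) (m : ℕ) (θs L : ℤ) (C : Finset ℕ) : ℕ ×ₗ (ℕ ×ₗ ℕ) :=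
  toLex (3 - (s.Kset C).card, toLex ((s.linkT m θs L (s.kmin C) C).toNat, (s.psum2 m θs L (s.kmin C) C).toNat))

omit [DecidableEq ι] in
/-- `k(C) ∈ K(C)` when the corner has positive residual order. -/
theorem kmin_mem {s : TState ι} {C : Finset ℕ} (h : 0 < s.thetaR C) : s.kmin C ∈ s.Kset C := by
  unfold kmin; rw [dif_pos (Kset_nonempty h)]; exact Finset.min'_mem _ _

omit [DecidableEq ι] in
/-- `k(C) ∈ C` when the corner has positive residual order. -/
theorem kmin_mem_cone {s : TState ι} {C : Finset ℕ} (h : 0 < s.thetaR C) : s.kmin C ∈ C :=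
  s.Kset_subset C (kmin_mem h)

/-- The link potential read with any labelling of the two link rays. -/
theorem linkT_eq {m : ℕ} {s : TState ι} {θs L : ℤ} {k : ℕ} {C : Finset ℕ} {i j : ℕ} (hij : i ≠ j) (hC : C.erase k = {i, j}) :
    s.linkT m θs L k C = PairPot.T (s.G2 m θs k) (s.E2 m θs L k i) (s.E2 m θs L k j) := by
  unfold linkT
  have hne : (C.erase k).Nonempty := by rw [hC]; exact ⟨i, by simp⟩
  rw [dif_pos hne]
  have hmin : (C.erase k).min' hne ∈ ({i, j} : Finset ℕ) := by rw [← hC]; exact Finset.min'_mem _ _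
  have hmax : (C.erase k).max' hne ∈ ({i, j} : Finset ℕ) := by rw [← hC]; exact Finset.max'_mem _ _
  have hcard : 1 < (C.erase k).card := by rw [hC, Finset.card_pair hij]; decide
  have hlt : (C.erase k).min' hne < (C.erase k).max' hne := Finset.min'_lt_max'_of_card _ hcard
  simp only [Finset.mem_insert, Finset.mem_singleton] at hmin hmax
  rcases hmin with h1 | h1 <;> rcases hmax with h2 | h2
  · rw [h1, h2] at hlt; exact absurd hlt (lt_irrefl _)
  · rw [h1, h2]
  · rw [h1, h2, PairPot.T_symm]
  · rw [h1, h2] at hlt; exact absurd hlt (lt_irrefl _)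

/-- The link potential is non-negative. -/
theorem linkT_nonneg (s : TState ι) (m : ℕ) (θs L : ℤ) (k : ℕ) (C : Finset ℕ) : 0 ≤ s.linkT m θs L k C := by
  unfold linkT; split_ifs
  · exact PairPot.T_nonneg _ _ _
  · exact le_rfl

/-- `β₂(r̄) ≤ E2 r g` for every generator. -/
theorem bmin2_le {m : ℕ} {s : TState ι} {θs L : ℤ} {k r : ℕ} {g : Option ι} (hg : g ∈ s.G2 m θs k) :
    s.bmin2 m θs L k r ≤ s.E2 m θs L k r g := by
  unfold bmin2; rw [dif_pos ⟨g, hg⟩]; exact Finset.inf'_le _ hg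

/-- The link minima are non-negative (non-negative state, positive phase value). -/
theorem bmin2_nonneg {m : ℕ} {s : TState ι} (hs : s.Nonneg) {θs L : ℤ} (hθ : 0 < θs) (hL : CommonMult m θs L) (k r : ℕ) :
    0 ≤ s.bmin2 m θs L k r := by
  unfold bmin2
  split_ifs with h
  · exact Finset.le_inf' _ _ (fun g hg => E2_nonneg hs hθ hL k r hg)
  · exact le_rfl

/-- The link minimum sum is non-negative. -/
theorem psum2_nonneg {m : ℕ} {s : TState ι} (hs : s.Nonneg) {θs L : ℤ} (hθ : 0 < θs) (hL : CommonMult m θs L) (k : ℕ)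
    (C : Finset ℕ) : 0 ≤ s.psum2 m θs L k C :=
  Finset.sum_nonneg (fun r _ => bmin2_nonneg hs hθ hL k r)

/-- A ray of `𝒞_k`'s link is REDUCED (`β₂ < θs·L`) iff the 2-face `{k, r}` is not admissible (K3a restated). -/
theorem bmin2_lt_iff_not_admissible {m : ℕ} {s : TState ι} (hs : s.Nonneg) {θs L : ℤ} (hθ : 0 < θs) (hL : CommonMult m θs L)
    {k r : ℕ} (hkr : k ≠ r) (hface : s.IsFace {k, r}) (hle : s.thetaR {k, r} ≤ θs) :
    s.bmin2 m θs L k r < θs * L ↔ ¬ s.Admissible m θs {k, r} := by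
  rw [admissible_pair_iff hs hθ hL hkr hface hle]
  have hne := s.G2_nonempty m hθ k
  unfold bmin2; rw [dif_pos hne]
  constructor
  · intro h hall
    obtain ⟨g, hg, hgeq⟩ := Finset.exists_mem_eq_inf' hne (s.E2 m θs L k r)
    have := hall g hg; rw [← hgeq] at this; omega
  · intro h
    by_contra hge
    apply h
    intro g hg
    exact (le_of_not_gt hge).trans (Finset.inf'_le _ hg)

end TState

end Summit.ResolutionOfSingularities.ResolutionOfSingularities.Theorems.CampaignW42.Toric
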